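import Literature.MathematicalPhysics.KineticTheory.HardSphereUniformGas
import Literature.MathematicalPhysics.KineticTheory.GoodConfigurations
import Literature.Analysis.FluidPDE.EmpiricalCollisionMeasureMeasurable
import HarnessLib

/-!
# Window kinematics of hard-sphere trajectories on `𝕋³`
# (helpers toward the rung-0 collision-count bound; crux `JParityClosure.OddContactSymmetry`,
# stmt-AtomisticToContinuum-13078, line `equilibrium-rung-mean-variance`, transfer debt "tightness")

Lead prover r-1 of the crux.  Deterministic facts about a single hard-sphere trajectory
(`IsHardSphereTrajectory`, right-continuous, binary collisions, free flight in between) on the flat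
torus with the minimal-image distance, used to turn the one- and two-collision WINDOW EVENTS of the
first-moment collision-count argument into STATIC events at the start of the window:

* `exists_close_pair_of_collision` (D1) — a collision in `[t, t + δ]` forces, at time `t`, a pair at
  distance in `[ε, ε + (‖vᵢ‖ + ‖vⱼ‖) δ]` (the first collision after `t` is preceded by free flight);
* `euclidDist_traj_le_of_speed_le` (L1) — under a speed bound `V` each particle moves at most
  `V (s' - s)` during `[s, s']` (continuous induction over the collision-free stretches);
* `torus_sepVec_translate`, `norm_sepVec_freeFlight_gt_of_isOutgoing` (NR) — local linearity of the
  minimal-image separation vector with the explicit radius `(1/2 - ε)/2`, and: free flight from an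
  OUTGOING contact configuration does not return the pair to contact before a particle has moved that
  far (`‖n + s g‖² = ε² + 2s⟪n,g⟫ + s²‖g‖² > ε²`);
* `exists_two_close_pairs_of_two_collisions` (D2) — two DISTINCT collision times in a window
  `[t, t + δ]` with `2Vδ < (1/2 - ε)/2` force two distinct unordered pairs each `(ε + 2Vδ)`-close at
  time `t` (a pair cannot collide twice in a row, so either the pairs differ or a third particle
  intervened) — the static signature of the "dirty" two-collision windows.

References: Gallagher–Saint-Raymond–Texier 2013 §4.1 (hard-sphere trajectories; Lemma 4.1.2: data
with a collision in a short window); Cercignani–Illner–Pulvirenti 1994 §4.2, App. 4.A.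
-/

noncomputable section

open MeasureTheory Set Filter Topology
open scoped ENNReal InnerProductSpace BigOperators

namespace Summit.AtomisticToContinuum.HydrodynamicLimit.Theorems

open Literature.Analysis.FluidPDE Literature.MathematicalPhysics.KineticTheory

-- `hε`, `hε2`, `hδ` are part of the fixed (D1) interface but are not needed for the proof.
set_option linter.unusedVariables false in
/-- **(D1)** On a hard-sphere trajectory on `𝕋³` (diameter `ε < 1/2`): if some collision time lies in
`[t, t + δ]`, then at time `t` some pair `i ≠ j` is at minimal-image distance in
`[ε, ε + (‖vᵢ(t)‖ + ‖vⱼ(t)‖) δ]` (the first collision after `t` is preceded by free flight;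
triangle inequality on the torus). [folklore] -/
theorem exists_close_pair_of_collision {N : ℕ} {ε : ℝ} (hε : 0 < ε) (hε2 : ε < 2⁻¹)
    {γ : ℝ → Config N (Fin 3) T3} (h : IsHardSphereTrajectory (Torus.geometry (Fin 3)) ε N γ)
    {t δ : ℝ} (hδ : 0 ≤ δ)
    (hcol : (collisionTimes (Torus.geometry (Fin 3)) ε γ ∩ Icc t (t + δ)).Nonempty) :
    ∃ i j : Fin N, i ≠ j ∧ ε ≤ Torus.euclidDist (γ t i).1 (γ t j).1 ∧
      Torus.euclidDist (γ t i).1 (γ t j).1 ≤ ε + (‖(γ t i).2‖ + ‖(γ t j).2‖) * δ := by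
  -- the first collision time `t₁ ∈ [t, t + δ]` and a pair `i ≠ j` in contact at time `t₁`
  obtain ⟨t₁, ⟨ht₁col, ht₁t, ht₁δ⟩, hmin⟩ :=
    Set.exists_min_image _ id (h.locFinite t (t + δ)) hcol
  obtain ⟨i, j, hij, hcontact⟩ := mem_collisionTimes.1 ht₁col
  have hdist₁ : Torus.euclidDist (γ t₁ i).1 (γ t₁ j).1 = ε := (mem_contactSet.1 hcontact).2
  -- free flight on `[t, t₁]`: the positions at time `t₁` are torus translates of those at `t`
  have hpos : ∀ k : Fin N, (γ t₁ k).1 =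
      (γ t k).1 + Literature.Analysis.FunctionSpaces.Torus.proj ((t₁ - t) • (γ t k).2) := by
    intro k
    have hfree : ∀ s ∈ Ico t t₁, (γ s k).1 =
        (γ t k).1 + Literature.Analysis.FunctionSpaces.Torus.proj ((s - t) • (γ t k).2) := by
      intro s hs
      have hγs : γ s = freeFlight (Torus.geometry (Fin 3)) (s - t) (γ t) := by
        refine h.free t s hs.1 fun τ hτ hτcol => ?_
        have hτmem : τ ∈ collisionTimes (Torus.geometry (Fin 3)) ε γ ∩ Icc t (t + δ) :=
          ⟨hτcol, hτ.1.le, hτ.2.trans (hs.2.le.trans ht₁δ)⟩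
        exact (not_le.2 (hτ.2.trans_lt hs.2)) (hmin τ hτmem)
      rw [hγs, freeFlight_apply, Torus.geometry_translate]
    rcases eq_or_lt_of_le ht₁t with rfl | hlt
    · simp
    · have hcl : t₁ ∈ closure (Ico t t₁) := by
        rw [closure_Ico hlt.ne]
        exact right_mem_Icc.2 hlt.le
      exact (Set.EqOn.closure (f := fun s => (γ s k).1)
        (g := fun s => (γ t k).1 +
          Literature.Analysis.FunctionSpaces.Torus.proj ((s - t) • (γ t k).2))
        hfree (h.pos_continuous k)
        (continuous_const.add (Literature.Analysis.FunctionSpaces.Torus.continuous_proj.comp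
          ((continuous_id.sub continuous_const).smul continuous_const)))) hcl
  -- each particle moves by at most `δ ‖vₖ(t)‖` during `[t, t₁]`
  have hmove : ∀ k : Fin N, Torus.euclidDist (γ t₁ k).1 (γ t k).1 ≤ δ * ‖(γ t k).2‖ := by
    intro k
    rw [hpos k]
    refine (euclidDist_add_proj_self_le _ _).trans ?_
    rw [norm_smul, Real.norm_eq_abs, abs_of_nonneg (sub_nonneg.2 ht₁t)]
    exact mul_le_mul_of_nonneg_right (by linarith) (norm_nonneg _)
  refine ⟨i, j, hij, mem_hardSphereDomain.1 (h.mem t) i j hij, ?_⟩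
  calc Torus.euclidDist (γ t i).1 (γ t j).1
      ≤ Torus.euclidDist (γ t i).1 (γ t₁ i).1 + Torus.euclidDist (γ t₁ i).1 (γ t j).1 :=
        torus_euclidDist_triangle _ _ _
    _ ≤ Torus.euclidDist (γ t i).1 (γ t₁ i).1 +
          (Torus.euclidDist (γ t₁ i).1 (γ t₁ j).1 + Torus.euclidDist (γ t₁ j).1 (γ t j).1) :=
        add_le_add le_rfl (torus_euclidDist_triangle _ _ _)
    _ ≤ δ * ‖(γ t i).2‖ + (ε + δ * ‖(γ t j).2‖) := by
        rw [Torus.euclidDist_comm (γ t i).1, hdist₁]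
        exact add_le_add (hmove i) (add_le_add le_rfl (hmove j))
    _ = ε + (‖(γ t i).2‖ + ‖(γ t j).2‖) * δ := by ring


/-- **(L1)** Along a hard-sphere trajectory on `𝕋³` whose speeds are bounded by `V`, each particle
moves at most `V (s' - s)` (minimal-image distance) during `[s, s']`. [folklore] -/
theorem euclidDist_traj_le_of_speed_le {N : ℕ} {ε : ℝ} (hε : 0 < ε) (hε2 : ε < 2⁻¹)
    {γ : ℝ → Config N (Fin 3) T3} (h : IsHardSphereTrajectory (Torus.geometry (Fin 3)) ε N γ)
    {V : ℝ} (hV : ∀ s k, ‖(γ s k).2‖ ≤ V) {s s' : ℝ} (hss' : s ≤ s') (k : Fin N) :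
    Torus.euclidDist (γ s' k).1 (γ s k).1 ≤ V * (s' - s) := by
  have _ := hε.trans hε2
  -- the displacement from time `s`, a continuous function of time
  set D : ℝ → ℝ := fun t => Torus.euclidDist (γ t k).1 (γ s k).1 with hD
  have hDc : Continuous D := by
    have h2 : Continuous fun t => ((γ t k).1, (γ s k).1) :=
      (h.pos_continuous k).prodMk continuous_const
    simpa only [Function.comp_def] using Torus.continuous_euclidDist.comp h2
  -- continuous induction on `[s, s']` for the closed set `S = {t | D t ≤ V (t - s)}`
  set S : Set ℝ := {t | D t ≤ V * (t - s)} with hS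
  have hSc : IsClosed S := isClosed_le hDc (by fun_prop)
  have hmem : s ∈ S := by simp [hS, hD]
  have key : Icc s s' ⊆ S := by
    refine (hSc.inter isClosed_Icc).Icc_subset_of_forall_mem_nhdsWithin hmem ?_
    rintro x ⟨hxS, -⟩
    -- a collision-free stretch `(x, u)` to the right of `x`: free flight from `γ x` on `[x, u)`
    obtain ⟨u, hxu, hfree⟩ := h.exists_Ioo_right_free x
    refine mem_of_superset (Ioo_mem_nhdsGT hxu) fun t ht => ?_
    have hff : γ t = freeFlight (Torus.geometry (Fin 3)) (t - x) (γ x) :=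
      h.eq_freeFlight_of_Ioo_free hfree ⟨ht.1.le, ht.2⟩
    have htx : 0 < t - x := sub_pos.2 ht.1
    have hstep : Torus.euclidDist (γ t k).1 (γ x k).1 ≤ V * (t - x) := by
      simp only [hff, freeFlight_apply, Torus.geometry_translate]
      refine (euclidDist_add_proj_self_le _ _).trans ?_
      rw [norm_smul, Real.norm_eq_abs, abs_of_pos htx, mul_comm]
      exact mul_le_mul_of_nonneg_right (hV x k) htx.le
    show D t ≤ V * (t - s)
    have hxS' : D x ≤ V * (x - s) := hxS
    calc D t ≤ Torus.euclidDist (γ t k).1 (γ x k).1 + D x := torus_euclidDist_triangle _ _ _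
      _ ≤ V * (t - x) + V * (x - s) := add_le_add hstep hxS'
      _ = V * (t - s) := by ring
  exact key ⟨hss', le_rfl⟩


/-- **Local linearity of the torus separation vector, explicit radius**: for a pair at minimal-image
distance `≤ ε < 1/2` and translations of size `< (1/2 - ε)/2`,
`sepVec (x + proj v) (y + proj w) = sepVec x y + (v - w)`. [folklore] -/
theorem torus_sepVec_translate {ε : ℝ} (hε2 : ε < 2⁻¹) {x y : T3} {v w : V3}
    (hxy : ‖(Torus.geometry (Fin 3)).sepVec x y‖ ≤ ε)
    (hv : ‖v‖ < (2⁻¹ - ε) / 2) (hw : ‖w‖ < (2⁻¹ - ε) / 2) :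
    (Torus.geometry (Fin 3)).sepVec ((Torus.geometry (Fin 3)).translate x v)
        ((Torus.geometry (Fin 3)).translate y w) =
      (Torus.geometry (Fin 3)).sepVec x y + (v - w) := by
  -- (`hε2` is implied by `hv : ‖v‖ < (2⁻¹ - ε) / 2`; it is kept in the signature for readability)
  have _ := hε2
  change Torus.reprSym (x + Literature.Analysis.FunctionSpaces.Torus.proj v -
      (y + Literature.Analysis.FunctionSpaces.Torus.proj w)) = Torus.reprSym (x - y) + (v - w)
  have hxy' : x + Literature.Analysis.FunctionSpaces.Torus.proj v -
      (y + Literature.Analysis.FunctionSpaces.Torus.proj w) =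
      (x - y) + Literature.Analysis.FunctionSpaces.Torus.proj (v - w) := by
    rw [sub_eq_add_neg v w, Literature.Analysis.FunctionSpaces.Torus.proj_add,
      Literature.Analysis.FunctionSpaces.Torus.proj_neg]
    abel
  rw [hxy']
  refine Torus.reprSym_add_proj fun i => ?_
  have h1 : |Torus.reprSym (x - y) i| ≤ ε := (Torus.abs_reprSym_apply_le_norm _ i).trans hxy
  have h2 : |(v - w) i| < 2⁻¹ - ε := by
    calc |(v - w) i| ≤ ‖v - w‖ := by simpa using PiLp.norm_apply_le (v - w) i
      _ ≤ ‖v‖ + ‖w‖ := norm_sub_le v w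
      _ < 2⁻¹ - ε := by linarith
  rw [abs_le] at h1
  rw [abs_lt] at h2
  constructor <;> linarith [h1.1, h1.2, h2.1, h2.2]

/-- **(NR)** Free flight from an OUTGOING contact configuration of the pair `(i, j)` does not bring
that pair back to contact before either particle has moved `(1/2 - ε)/2`:
`‖n + s g‖² = ε² + 2s⟪n, g⟫ + s²‖g‖² > ε²`. [folklore] -/
theorem norm_sepVec_freeFlight_gt_of_isOutgoing {N : ℕ} {ε : ℝ} (hε : 0 < ε) (hε2 : ε < 2⁻¹)
    {z : Config N (Fin 3) T3} {i j : Fin N}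
    (hc : ‖(Torus.geometry (Fin 3)).sepVec (z i).1 (z j).1‖ = ε)
    (hout : IsOutgoing (Torus.geometry (Fin 3)) z i j) {s : ℝ} (hs : 0 < s)
    (hsi : s * ‖(z i).2‖ < (2⁻¹ - ε) / 2) (hsj : s * ‖(z j).2‖ < (2⁻¹ - ε) / 2) :
    ε < ‖(Torus.geometry (Fin 3)).sepVec (freeFlight (Torus.geometry (Fin 3)) s z i).1
      (freeFlight (Torus.geometry (Fin 3)) s z j).1‖ := by
  have hvi : ‖s • (z i).2‖ < (2⁻¹ - ε) / 2 := by
    rwa [norm_smul, Real.norm_eq_abs, abs_of_pos hs]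
  have hvj : ‖s • (z j).2‖ < (2⁻¹ - ε) / 2 := by
    rwa [norm_smul, Real.norm_eq_abs, abs_of_pos hs]
  have hlin : (Torus.geometry (Fin 3)).sepVec (freeFlight (Torus.geometry (Fin 3)) s z i).1
      (freeFlight (Torus.geometry (Fin 3)) s z j).1 =
      (Torus.geometry (Fin 3)).sepVec (z i).1 (z j).1 + s • ((z i).2 - (z j).2) := by
    rw [freeFlight_apply, freeFlight_apply, torus_sepVec_translate hε2 hc.le hvi hvj, smul_sub]
  have hsq : ‖(Torus.geometry (Fin 3)).sepVec (freeFlight (Torus.geometry (Fin 3)) s z i).1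
      (freeFlight (Torus.geometry (Fin 3)) s z j).1‖ ^ 2 =
      ε ^ 2 + 2 * s * ⟪(Torus.geometry (Fin 3)).sepVec (z i).1 (z j).1, (z i).2 - (z j).2⟫_ℝ +
        s ^ 2 * ‖(z i).2 - (z j).2‖ ^ 2 := by
    rw [hlin, norm_add_sq_real, norm_smul, inner_smul_right, Real.norm_eq_abs, mul_pow, sq_abs, hc]
    ring
  have hpos : 0 < ⟪(Torus.geometry (Fin 3)).sepVec (z i).1 (z j).1, (z i).2 - (z j).2⟫_ℝ := hout
  refine (sq_lt_sq₀ hε.le (norm_nonneg _)).1 ?_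
  rw [hsq]
  nlinarith [sq_nonneg s, sq_nonneg ‖(z i).2 - (z j).2‖, mul_pos hs hpos]


/-- **Closeness at the window start.** On a hard-sphere trajectory on `𝕋³` with speeds `≤ V`, a
pair `(p, q)` in contact at a time `s ∈ [t, t + δ]` is at minimal-image distance `≤ ε + 2 V δ` at
time `t` (triangle inequality on the torus twice and (L1) for the two displacements over `[t, s]`).
[folklore] -/
theorem euclidDist_le_of_mem_contactSet_of_mem_Icc {N : ℕ} {ε : ℝ} (hε : 0 < ε) (hε2 : ε < 2⁻¹)
    {γ : ℝ → Config N (Fin 3) T3} (h : IsHardSphereTrajectory (Torus.geometry (Fin 3)) ε N γ)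
    {V : ℝ} (hV : ∀ s k, ‖(γ s k).2‖ ≤ V) {t δ s : ℝ} (hs : s ∈ Icc t (t + δ)) {p q : Fin N}
    (hc : γ s ∈ contactSet (Torus.geometry (Fin 3)) N ε p q) :
    Torus.euclidDist (γ t p).1 (γ t q).1 ≤ ε + 2 * V * δ := by
  have hdist : Torus.euclidDist (γ s p).1 (γ s q).1 = ε := (mem_contactSet.1 hc).2
  have hV0 : 0 ≤ V := (norm_nonneg _).trans (hV t p)
  have hsδ : s - t ≤ δ := by linarith [hs.2]
  have hmove : ∀ k : Fin N, Torus.euclidDist (γ s k).1 (γ t k).1 ≤ V * δ := fun k =>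
    (euclidDist_traj_le_of_speed_le hε hε2 h hV hs.1 k).trans (mul_le_mul_of_nonneg_left hsδ hV0)
  calc Torus.euclidDist (γ t p).1 (γ t q).1
      ≤ Torus.euclidDist (γ t p).1 (γ s p).1 + Torus.euclidDist (γ s p).1 (γ t q).1 :=
        torus_euclidDist_triangle _ _ _
    _ ≤ Torus.euclidDist (γ t p).1 (γ s p).1 +
          (Torus.euclidDist (γ s p).1 (γ s q).1 + Torus.euclidDist (γ s q).1 (γ t q).1) :=
        add_le_add le_rfl (torus_euclidDist_triangle _ _ _)
    _ ≤ V * δ + (ε + V * δ) := by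
        rw [Torus.euclidDist_comm (γ t p).1, hdist]
        exact add_le_add (hmove p) (add_le_add le_rfl (hmove q))
    _ = ε + 2 * V * δ := by ring

/-- **Positions do not jump.** On a hard-sphere trajectory on `𝕋³`, if `(s, u)` is collision-free
and `s < u`, then the POSITIONS at time `u` are the free-flight positions from `γ s` after time
`u - s` (the velocities may jump at `u`; continuity of positions and of the torus translation).
[folklore] -/
theorem traj_apply_fst_eq_freeFlight_of_Ioo_free {N : ℕ} {ε : ℝ} {γ : ℝ → Config N (Fin 3) T3}
    (h : IsHardSphereTrajectory (Torus.geometry (Fin 3)) ε N γ) {s u : ℝ} (hsu : s < u)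
    (hfree : ∀ σ ∈ Ioo s u, σ ∉ collisionTimes (Torus.geometry (Fin 3)) ε γ) (k : Fin N) :
    (γ u k).1 = (freeFlight (Torus.geometry (Fin 3)) (u - s) (γ s) k).1 := by
  rw [← h.leftLim_apply_fst Torus.continuous_geometry_translate u k,
    h.leftLim_eq_freeFlight Torus.continuous_geometry_translate hsu hfree]

/-- **(D2), ordered version.** On a hard-sphere trajectory on `𝕋³` with speeds `≤ V`, if two
collision times `t₁ < t₂` lie in `[t, t + δ]` with `2 V δ < (1/2 - ε)/2`, then at time `t` there
are two DISTINCT unordered pairs each at minimal-image distance `≤ ε + 2 V δ`: the pair colliding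
at `t₁` and the pair colliding at the first collision time after `t₁`; these pairs differ, since the
pair colliding at `t₁` is outgoing there and flies freely up to the next collision, so by (NR) it is
not in contact at that time. [folklore] -/
theorem exists_two_close_pairs_of_two_collisions_of_lt {N : ℕ} {ε : ℝ} (hε : 0 < ε)
    (hε2 : ε < 2⁻¹) {γ : ℝ → Config N (Fin 3) T3}
    (h : IsHardSphereTrajectory (Torus.geometry (Fin 3)) ε N γ)
    {V : ℝ} (hV : ∀ s k, ‖(γ s k).2‖ ≤ V) {t δ : ℝ} (hδ : 0 ≤ δ) (hVδ : 2 * V * δ < (2⁻¹ - ε) / 2)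
    {t₁ t₂ : ℝ} (ht₁ : t₁ ∈ collisionTimes (Torus.geometry (Fin 3)) ε γ ∩ Icc t (t + δ))
    (ht₂ : t₂ ∈ collisionTimes (Torus.geometry (Fin 3)) ε γ ∩ Icc t (t + δ)) (hlt : t₁ < t₂) :
    ∃ i j k l : Fin N, i ≠ j ∧ k ≠ l ∧ ({i, j} : Finset (Fin N)) ≠ {k, l} ∧
      Torus.euclidDist (γ t i).1 (γ t j).1 ≤ ε + 2 * V * δ ∧
      Torus.euclidDist (γ t k).1 (γ t l).1 ≤ ε + 2 * V * δ := by
  -- the first collision time `t₂'` after `t₁`: `t₁ < t₂' ≤ t₂`, and `(t₁, t₂')` is collision-free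
  obtain ⟨t₂', ⟨ht₂'col, ht₁t₂'⟩, hmin⟩ :
      ∃ t₂', IsLeast (collisionTimes (Torus.geometry (Fin 3)) ε γ ∩ Ioi t₁) t₂' :=
    ⟨_, h.isLeast_nthCollisionTime_zero ⟨t₂, ht₂.1, hlt⟩⟩
  have ht₁t₂' : t₁ < t₂' := ht₁t₂'
  have ht₂'le : t₂' ≤ t₂ := hmin ⟨ht₂.1, hlt⟩
  have ht₂'mem : t₂' ∈ Icc t (t + δ) := ⟨ht₁.2.1.trans ht₁t₂'.le, ht₂'le.trans ht₂.2.2⟩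
  have hfree : ∀ σ ∈ Ioo t₁ t₂', σ ∉ collisionTimes (Torus.geometry (Fin 3)) ε γ :=
    fun σ hσ hσcol => (not_le.2 hσ.2) (hmin ⟨hσcol, hσ.1⟩)
  -- the pairs in contact at `t₁` and at `t₂'`; both are close at time `t`
  obtain ⟨i, j, hij, hc₁⟩ := mem_collisionTimes.1 ht₁.1
  obtain ⟨k, l, hkl, hc₂⟩ := mem_collisionTimes.1 ht₂'col
  refine ⟨i, j, k, l, hij, hkl, fun hpair => ?_,
    euclidDist_le_of_mem_contactSet_of_mem_Icc hε hε2 h hV ht₁.2 hc₁,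
    euclidDist_le_of_mem_contactSet_of_mem_Icc hε hε2 h hV ht₂'mem hc₂⟩
  -- if `{i, j} = {k, l}`, the pair `(i, j)` is in contact at `t₂'` ...
  have hc₂' : ‖(Torus.geometry (Fin 3)).sepVec (γ t₂' i).1 (γ t₂' j).1‖ = ε := by
    have hk : k ∈ ({i, j} : Finset (Fin N)) := by rw [hpair]; simp
    have hl : l ∈ ({i, j} : Finset (Fin N)) := by rw [hpair]; simp
    simp only [Finset.mem_insert, Finset.mem_singleton] at hk hl
    have hd : Torus.euclidDist (γ t₂' k).1 (γ t₂' l).1 = ε := (mem_contactSet.1 hc₂).2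
    change Torus.euclidDist (γ t₂' i).1 (γ t₂' j).1 = ε
    rcases hk with rfl | rfl <;> rcases hl with rfl | rfl
    · exact absurd rfl hkl
    · exact hd
    · rwa [Torus.euclidDist_comm]
    · exact absurd rfl hkl
  -- ... whereas the positions at `t₂'` are the free-flight positions from the OUTGOING contact
  -- configuration `γ t₁`, which by (NR) are not in contact: contradiction
  have hpos : ∀ m, (γ t₂' m).1 = (freeFlight (Torus.geometry (Fin 3)) (t₂' - t₁) (γ t₁) m).1 :=
    traj_apply_fst_eq_freeFlight_of_Ioo_free h ht₁t₂' hfree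
  have hout : IsOutgoing (Torus.geometry (Fin 3)) (γ t₁) i j :=
    h.isOutgoing_of_mem_contactSet hij hc₁
  have hs : 0 < t₂' - t₁ := sub_pos.2 ht₁t₂'
  have hsδ : t₂' - t₁ ≤ δ := by linarith [ht₂'mem.2, ht₁.2.1]
  have hV0 : 0 ≤ V := (norm_nonneg _).trans (hV t₁ i)
  have hsm : ∀ m, (t₂' - t₁) * ‖(γ t₁ m).2‖ < (2⁻¹ - ε) / 2 := fun m =>
    (mul_le_mul hsδ (hV t₁ m) (norm_nonneg _) hδ).trans_lt (by linarith [mul_nonneg hV0 hδ])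
  have hgt := norm_sepVec_freeFlight_gt_of_isOutgoing hε hε2 (mem_contactSet.1 hc₁).2 hout hs
    (hsm i) (hsm j)
  rw [← hpos i, ← hpos j, hc₂'] at hgt
  exact lt_irrefl _ hgt

/-- **(D2)** On a hard-sphere trajectory on `𝕋³` with speeds `≤ V`, if two distinct collision times
lie in `[t, t + δ]` with `2 V δ < (1/2 - ε)/2`, then at time `t` there are two DISTINCT unordered pairs
each at minimal-image distance `≤ ε + 2 V δ` (consecutive collisions of the same pair are impossible
by (NR), so either the two collisions have different pairs or a third particle intervened). [folklore] -/
theorem exists_two_close_pairs_of_two_collisions {N : ℕ} {ε : ℝ} (hε : 0 < ε) (hε2 : ε < 2⁻¹)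
    {γ : ℝ → Config N (Fin 3) T3} (h : IsHardSphereTrajectory (Torus.geometry (Fin 3)) ε N γ)
    {V : ℝ} (hV : ∀ s k, ‖(γ s k).2‖ ≤ V) {t δ : ℝ} (hδ : 0 ≤ δ) (hVδ : 2 * V * δ < (2⁻¹ - ε) / 2)
    {t₁ t₂ : ℝ} (ht₁ : t₁ ∈ collisionTimes (Torus.geometry (Fin 3)) ε γ ∩ Icc t (t + δ))
    (ht₂ : t₂ ∈ collisionTimes (Torus.geometry (Fin 3)) ε γ ∩ Icc t (t + δ)) (hne : t₁ ≠ t₂) :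
    ∃ i j k l : Fin N, i ≠ j ∧ k ≠ l ∧ ({i, j} : Finset (Fin N)) ≠ {k, l} ∧
      Torus.euclidDist (γ t i).1 (γ t j).1 ≤ ε + 2 * V * δ ∧
      Torus.euclidDist (γ t k).1 (γ t l).1 ≤ ε + 2 * V * δ := by
  rcases lt_or_gt_of_ne hne with hlt | hgt
  · exact exists_two_close_pairs_of_two_collisions_of_lt hε hε2 h hV hδ hVδ ht₁ ht₂ hlt
  · exact exists_two_close_pairs_of_two_collisions_of_lt hε hε2 h hV hδ hVδ ht₂ ht₁ hgt


/-- **Registered helper stub `stub_windowKinematics`** of crux stmt-AtomisticToContinuum-13078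
(rung-0 collision-count bound, part 2: window kinematics; = `exists_two_close_pairs_of_two_collisions`
in signature form). [folklore] -/
theorem stub_windowKinematics :
    ∀ (N : ℕ) (ε : ℝ), 0 < ε → ε < 2⁻¹ → ∀ (γ : ℝ → Config N (Fin 3) T3), IsHardSphereTrajectory (Torus.geometry (Fin 3)) ε N γ → ∀ (V t δ : ℝ), (∀ s k, ‖(γ s k).2‖ ≤ V) → 0 ≤ δ → 2 * V * δ < (2⁻¹ - ε) / 2 → ∀ (t₁ t₂ : ℝ), t₁ ∈ collisionTimes (Torus.geometry (Fin 3)) ε γ ∩ Icc t (t + δ) → t₂ ∈ collisionTimes (Torus.geometry (Fin 3)) ε γ ∩ Icc t (t + δ) → t₁ ≠ t₂ → ∃ i j k l : Fin N, i ≠ j ∧ k ≠ l ∧ ({i, j} : Finset (Fin N)) ≠ {k, l} ∧ Torus.euclidDist (γ t i).1 (γ t j).1 ≤ ε + 2 * V * δ ∧ Torus.euclidDist (γ t k).1 (γ t l).1 ≤ ε + 2 * V * δ :=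
  fun _N _ε hε hε2 _γ h _V _t _δ hV hδ hVδ _t₁ _t₂ ht₁ ht₂ hne =>
    exists_two_close_pairs_of_two_collisions hε hε2 h hV hδ hVδ ht₁ ht₂ hne

end Summit.AtomisticToContinuum.HydrodynamicLimit.Theorems

end
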